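import Literature.Probability.RandomPlanarGeometry.SAWFiniteMemoryTwo
import Literature.Probability.RandomPlanarGeometry.SAWPulledLargeForceExpansionZdCostPolynomial
import HarnessLib

/-!
# `c_n(ℤ^d)` as a polynomial in the dimension: the top two coefficients `2^n d^n − (n−1)2^{n−1} d^{n−1}`

Topic `Literature/Probability/RandomPlanarGeometry` (uses `SAWFiniteMemoryTwo.lean`: `walks d n`, `memWalks d 2 n`, `memCount_two :
c_{n,2}(ℤ^d) = 2d(2d−1)^{n−1}`; `SAWPulledLargeForceExpansionZdCostPolynomial.lean`: the zero-extension transport `extend_mem_saws_iff`;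
`SAWCount.lean`: `saws d n`, `count d n = c_n(ℤ^d)`).

PRINTED CONTEXT (locators only; nothing below is quoted digit-for-digit). Madras–Slade, *The Self-Avoiding Walk* (1993): §1.1 p. 3
(`c₁ = 2d, c₂ = 2d(2d−1), c₃ = 2d(2d−1)², c₄ = 2d(2d−1)³ − 2d(2d−2)`), eq. (1.1.8) p. 5 (the `1/d` expansion of `μ`, after Fisher–Sykes
1959 / Fisher–Gaunt 1964); §1.2 p. 10 ("`c_{N,2} = 2d(2d−1)^{N−1}` … memory `τ = 2` simply rules out immediate reversals"). NOT IN PRINT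
in this form (lane statement): the structure theorem below for the difference `c_{n,2} − c_n` in every dimension.

THIS FILE (lane «pcv-sawmu», a-p1 g18; all PROVED, standard axioms, NO definitions — every object is a tree notion or an inline term):

* ★ `card_badClass_eq` — AXIS CLASSES OF THE NON-SELF-AVOIDING MEMORY-2 WALKS: the `n`-step memory-2 walks of `ℤ^{d+1}` that are not
  self-avoiding and whose set of used axes is a given `S` (`|S| = u + 1`) are equinumerous with those of `ℤ^{u+1}` using every axis
  (zero-extension along the increasing enumeration of `S`; `extend_mem_walks_iff`, `isMemory_extend_iff`);
* ★★ `card_allAxes_badClass_eq_zero` — A REPEAT COSTS TWO AXES: a memory-2 walk of length `n` that is not self-avoiding uses at most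
  `n − 2` axes (its first repeated site closes a loop of length `ℓ ≥ 3`, inside which every axis that occurs occurs at least twice —
  `two_mul_card_image_le_of_loop` —, so the walk uses `≤ ℓ/2 + (n − ℓ) ≤ n − 2` axes);
* ★★ `memCount_two_eq_count_add_sum_choose` — for every `n ≥ 1` and EVERY dimension `d`:
  `c_{n,2}(ℤ^d) = c_n(ℤ^d) + Σ_{u ≤ n−2} C(d,u) · G_n(u)` with `G_n(u) ∈ ℕ` the number of non-self-avoiding memory-2 walks of `ℤ^u`
  of length `n` using every axis (an inline `Finset.card`, independent of `d`);
* ★★★ `exists_polynomial_count_topTwo` — THE TOP TWO COEFFICIENTS: for every `n ≥ 1` there is `P ∈ ℚ[X]` with `natDegree P ≤ n`,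
  `[X^n] P = 2^n`, `[X^{n−1}] P = −(n−1)·2^{n−1}` and `c_n(ℤ^d) = P(d)` for every `d ∈ ℕ` (namely
  `P = 2X(2X−1)^{n−1} − Σ_{u ≤ n−2} G_n(u)·X(X−1)⋯(X−u+1)/u!`); ★ `exists_polynomial_count_topTwo'` — the same with the second
  coefficient written as `[X^n](P·X)` (the form used by the symbol calculus of `SAWPulledLargeForceExpansionZdTopSymbol.lean`'s sequel).

Use (sequel): with `N_{c,c+1}(ℤ^{d+1}) = c_c(ℤ^d)` (`SAWIrreducibleBridgeSpanOne.lean`) this is the SECOND SYMBOL of the irreducible-bridge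
cost census, the input of the leading coefficient `(−2)^{k−1}` of the large-force coefficients `c_k^{(d)}` in `d`.
[cite: MadrasSlade1993, §1.1 p. 3 and eq. (1.1.8) p. 5 (small-n counts and the 1/d expansion); §1.2 p. 10 (memory-2 count)]

Provenance: lane «pcv-sawmu», a-p1 g18 (2026-08-26). Numerical cross-check (not used): `c₄`: `G₄ = (0,0,8)`, `c_{4,2} − c₄ = 2d(2d−2) =
8·C(d,2) + 0` ✓; `c₆`: `c_{6,2} − c₆ = 48d⁴ − 80d³ + 32d` (tree `count_six_eq`), degree `4 = n − 2`.
-/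

noncomputable section

open Finset
open scoped BigOperators
open Literature.Probability.LatticeModels
open Literature.Probability.RandomPlanarGeometry.SAW

namespace Literature.Probability.RandomPlanarGeometry.SAW.Zd

/-! ### Zero-extension of sites along an injection of coordinates (plumbing) -/

section Extend

variable {u d : ℕ} {e : Fin u → Fin d}

/-- The zero-extension agrees with `x` on the image coordinates. [cite: MadrasSlade1993, §1.1 (1.1.8); lane plumbing] -/
private theorem tc_extend_apply_image (he : Function.Injective e) (x : Site u) (a : Fin u) :
    Function.extend e x 0 (e a) = x a :=
  he.extend_apply _ _ _

/-- The zero-extension vanishes off the image coordinates. [cite: MadrasSlade1993, §1.1 (1.1.8); lane plumbing] -/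
private theorem tc_extend_apply_of_not_exists (x : Site u) {j : Fin d} (hj : ¬ ∃ a, e a = j) :
    Function.extend e x 0 j = 0 := by
  rw [Function.extend_apply' _ _ _ hj]; rfl

/-- The zero-extension is subtractive. [cite: MadrasSlade1993, §1.1 (1.1.8); lane plumbing] -/
private theorem tc_extend_sub (he : Function.Injective e) (x y : Site u) :
    Function.extend e (x - y) 0 = Function.extend e x 0 - Function.extend e y (0 : Fin d → ℤ) := by
  funext j
  by_cases hj : ∃ a, e a = j
  · obtain ⟨a, rfl⟩ := hj
    simp only [Pi.sub_apply, tc_extend_apply_image he]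
  · simp only [Pi.sub_apply, tc_extend_apply_of_not_exists _ hj, sub_zero]

/-- The zero-extension of `0` is `0`. [cite: MadrasSlade1993, §1.1 (1.1.8); lane plumbing] -/
private theorem tc_extend_zero : Function.extend e (0 : Site u) 0 = (0 : Site d) := by
  funext j
  classical
  rw [Function.extend_def]
  split_ifs <;> rfl

/-- `Function.extend e x 0 = 0 ↔ x = 0`. [cite: MadrasSlade1993, §1.1 (1.1.8); lane plumbing] -/
private theorem tc_extend_eq_zero_iff (he : Function.Injective e) (x : Site u) :
    Function.extend e x (0 : Fin d → ℤ) = 0 ↔ x = 0 := by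
  constructor
  · intro h
    funext a
    have := congrFun h (e a)
    rwa [tc_extend_apply_image he] at this
  · rintro rfl
    exact tc_extend_zero

/-- `x ↦ Function.extend e x 0` is injective. [cite: MadrasSlade1993, §1.1 (1.1.8); lane plumbing] -/
private theorem tc_extend_eq_extend_iff (he : Function.Injective e) {x y : Site u} :
    Function.extend e x (0 : Fin d → ℤ) = Function.extend e y 0 ↔ x = y := by
  constructor
  · intro h
    funext a
    have := congrFun h (e a)
    simpa only [tc_extend_apply_image he] using this
  · rintro rfl; rfl

/-- The zero-extension of a unit coordinate vector is a unit coordinate vector. [cite: MadrasSlade1993, §1.1 (1.1.8); lane plumbing] -/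
private theorem tc_extend_single (he : Function.Injective e) (a : Fin u) (s : ℤ) :
    Function.extend e (Pi.single a s) 0 = (Pi.single (e a) s : Site d) := by
  funext j
  by_cases hj : ∃ b, e b = j
  · obtain ⟨b, rfl⟩ := hj
    rw [tc_extend_apply_image he]
    by_cases hab : b = a
    · subst hab; simp
    · rw [Pi.single_eq_of_ne hab, Pi.single_eq_of_ne (fun h => hab (he h))]
  · rw [tc_extend_apply_of_not_exists _ hj, Pi.single_eq_of_ne]
    rintro rfl; exact hj ⟨a, rfl⟩

/-- The zero-extension preserves adjacency in both directions. [cite: MadrasSlade1993, §1.1 (p. 1: nearest-neighbour steps); lane plumbing] -/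
private theorem tc_adj_extend_iff (he : Function.Injective e) (x y : Site u) :
    (zdGraph d).Adj (Function.extend e x 0) (Function.extend e y 0) ↔ (zdGraph u).Adj x y := by
  rw [zdGraph_adj_iff_sub, zdGraph_adj_iff_sub, ← tc_extend_sub he, ← tc_extend_sub he]
  constructor
  · rintro ⟨j, hj⟩
    have hjim : ∃ a, e a = j := by
      by_contra hne
      rcases hj with hj | hj
      · have := congrFun hj j
        rw [tc_extend_apply_of_not_exists _ hne] at this
        simp at this
      · have := congrFun hj j
        rw [tc_extend_apply_of_not_exists _ hne] at this
        simp at this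
    obtain ⟨a, rfl⟩ := hjim
    refine ⟨a, ?_⟩
    rcases hj with hj | hj
    · left
      have key : Function.extend e (y - x) 0 = Function.extend e (Pi.single a 1) (0 : Fin d → ℤ) := by
        rw [hj, tc_extend_single he]
      exact (tc_extend_eq_extend_iff he).1 key
    · right
      have key : Function.extend e (x - y) 0 = Function.extend e (Pi.single a 1) (0 : Fin d → ℤ) := by
        rw [hj, tc_extend_single he]
      exact (tc_extend_eq_extend_iff he).1 key
  · rintro ⟨a, ha | ha⟩
    · exact ⟨e a, Or.inl (by rw [ha, tc_extend_single he])⟩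
    · exact ⟨e a, Or.inr (by rw [ha, tc_extend_single he])⟩

end Extend

/-! ### Transport of walks and of the memory condition -/

section Transport

variable {u d : ℕ} {e : Fin u → Fin d}

/-- A vertex function and its zero-extension are `n`-step walks together. [cite: MadrasSlade1993, §1.2 (p. 10); lane plumbing] -/
theorem extend_mem_walks_iff (he : Function.Injective e) {n : ℕ} (ω : ℕ → Site u) :
    (fun i => Function.extend e (ω i) (0 : Fin d → ℤ)) ∈ walks d n ↔ ω ∈ walks u n := by
  rw [mem_walks, mem_walks]
  simp only [tc_extend_eq_zero_iff he, tc_extend_eq_extend_iff he, tc_adj_extend_iff he]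

/-- The memory condition is invariant under zero-extension. [cite: MadrasSlade1993, §1.2 (p. 10); lane plumbing] -/
theorem isMemory_extend_iff (he : Function.Injective e) {τ n : ℕ} (ω : ℕ → Site u) :
    IsMemory τ n (fun i => Function.extend e (ω i) (0 : Fin d → ℤ)) ↔ IsMemory τ n ω := by
  unfold IsMemory
  simp only [ne_eq, tc_extend_eq_extend_iff he]

/-- A vertex function and its zero-extension are memory-`τ` walks together. [cite: MadrasSlade1993, §1.2 (p. 10); lane plumbing] -/
theorem extend_mem_memWalks_iff (he : Function.Injective e) {τ n : ℕ} (ω : ℕ → Site u) :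
    (fun i => Function.extend e (ω i) (0 : Fin d → ℤ)) ∈ memWalks d τ n ↔ ω ∈ memWalks u τ n := by
  rw [mem_memWalks, mem_memWalks, extend_mem_walks_iff he, isMemory_extend_iff he]

end Transport


/-! ### A repeat costs two axes -/

section Repeat

variable {D n : ℕ}

/-- The steps of a walk are unit coordinate vectors `± e_j`. [cite: MadrasSlade1993, §1.1 (p. 1); lane plumbing] -/
private theorem tc_exists_step_single {ω : ℕ → Site D} (hω : ω ∈ walks D n) {k : ℕ} (hk : k < n) :
    ∃ j : Fin D, ∃ s : ℤ, (s = 1 ∨ s = -1) ∧ ω (k + 1) - ω k = Pi.single j s := by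
  obtain ⟨j, hj | hj⟩ := (zdGraph_adj_iff_sub _ _).1 ((mem_walks.1 hω).2.2 k hk)
  · exact ⟨j, 1, Or.inl rfl, hj⟩
  · refine ⟨j, -1, Or.inr rfl, ?_⟩
    rw [Pi.single_neg, ← hj, neg_sub]

/-- Each step of a walk changes exactly one coordinate, by `±1`. [cite: MadrasSlade1993, §1.1 (p. 1); lane plumbing] -/
private theorem tc_exists_axis {ω : ℕ → Site D} (hω : ω ∈ walks D n) {k : ℕ} (hk : k < n) :
    ∃ a : Fin D, (ω (k + 1) a - ω k a = 1 ∨ ω (k + 1) a - ω k a = -1) ∧ ∀ b, b ≠ a → ω (k + 1) b = ω k b := by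
  obtain ⟨j, s, hs, hjs⟩ := tc_exists_step_single hω hk
  refine ⟨j, ?_, fun b hb => ?_⟩
  · have h := congrFun hjs j
    rw [Pi.sub_apply, Pi.single_eq_same] at h
    rcases hs with rfl | rfl
    · exact Or.inl h
    · exact Or.inr h
  · have h := congrFun hjs b
    rw [Pi.sub_apply, Pi.single_eq_of_ne hb] at h
    exact sub_eq_zero.1 h

/-- A coordinate that is nonzero at some time was changed by an earlier step. [cite: MadrasSlade1993, §1.1 (p. 1); lane plumbing] -/
private theorem tc_exists_step_ne {ω : ℕ → Site D} (h0 : ω 0 = 0) {a : Fin D} {i : ℕ} (hi : ω i a ≠ 0) :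
    ∃ k < i, ω (k + 1) a ≠ ω k a := by
  induction i with
  | zero => exact absurd (by rw [h0]; rfl) hi
  | succ i ih =>
    by_cases h : ω (i + 1) a = ω i a
    · obtain ⟨k, hk, hne⟩ := ih (by rwa [h] at hi)
      exact ⟨k, by omega, hne⟩
    · exact ⟨i, by omega, h⟩

/-- ★ In a closed stretch `ω i = ω j` of a walk, every axis that is stepped on is stepped on at least twice: if `ax k` is the axis
of step `k` for `i ≤ k < j`, then `2 · #(ax '' [i, j)) ≤ j − i`. [cite: MadrasSlade1993, §1.1 (p. 3: the loops behind c₄ = 2d(2d−1)³ − 2d(2d−2)); lane lemma] -/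
theorem two_mul_card_image_le_of_loop {ω : ℕ → Site D} (hω : ω ∈ walks D n) {i j : ℕ} (hij : i ≤ j) (hjn : j ≤ n)
    (hloop : ω i = ω j) (ax : ℕ → Fin D) (hax : ∀ k, i ≤ k → k < j → ∀ b, b ≠ ax k → ω (k + 1) b = ω k b) :
    2 * ((Finset.Ico i j).image ax).card ≤ j - i := by
  classical
  -- fibres of `ax` on `[i, j)`
  have hfib : (Finset.Ico i j).card = ∑ a ∈ (Finset.Ico i j).image ax, ((Finset.Ico i j).filter fun k => ax k = a).card :=
    Finset.card_eq_sum_card_image ax (Finset.Ico i j)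
  -- each fibre has at least two elements
  have htwo : ∀ a ∈ (Finset.Ico i j).image ax, 2 ≤ ((Finset.Ico i j).filter fun k => ax k = a).card := by
    intro a ha
    -- the telescoping sum of the increments of coordinate `a` over `[i, j)` vanishes
    have htel : ∑ k ∈ Finset.Ico i j, (ω (k + 1) a - ω k a) = 0 := by
      rw [Finset.sum_Ico_eq_sum_range]
      have h := Finset.sum_range_sub (fun k => ω (i + k) a) (j - i)
      have hji : i + (j - i) = j := by omega
      simp only [hji, Nat.add_zero] at h
      rw [show ∑ k ∈ Finset.range (j - i), (ω (i + k + 1) a - ω (i + k) a) =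
        ∑ k ∈ Finset.range (j - i), (ω (i + (k + 1)) a - ω (i + k) a) from
        Finset.sum_congr rfl fun k _ => by rw [add_assoc], h, hloop, sub_self]
    -- only the fibre contributes
    have hsplit : ∑ k ∈ Finset.Ico i j, (ω (k + 1) a - ω k a) =
        ∑ k ∈ (Finset.Ico i j).filter (fun k => ax k = a), (ω (k + 1) a - ω k a) := by
      rw [← Finset.sum_filter_add_sum_filter_not (Finset.Ico i j) (fun k => ax k = a)]
      have hz : ∑ k ∈ (Finset.Ico i j).filter (fun k => ¬ ax k = a), (ω (k + 1) a - ω k a) = 0 :=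
        Finset.sum_eq_zero fun k hk => by
          obtain ⟨hk, hka⟩ := Finset.mem_filter.1 hk
          rw [Finset.mem_Ico] at hk
          rw [hax k hk.1 hk.2 a (fun h => hka h.symm), sub_self]
      rw [hz, add_zero]
    rw [hsplit] at htel
    -- a one-element fibre would give `±1 = 0`
    by_contra hlt
    have hpos : 0 < ((Finset.Ico i j).filter fun k => ax k = a).card := by
      rw [Finset.card_pos]
      obtain ⟨k, hk, rfl⟩ := Finset.mem_image.1 ha
      exact ⟨k, Finset.mem_filter.2 ⟨hk, rfl⟩⟩
    have hone : ((Finset.Ico i j).filter fun k => ax k = a).card = 1 := by omega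
    obtain ⟨k₀, hk₀⟩ := Finset.card_eq_one.1 hone
    rw [hk₀, Finset.sum_singleton] at htel
    have hk₀mem : k₀ ∈ (Finset.Ico i j).filter fun k => ax k = a := by rw [hk₀]; exact Finset.mem_singleton_self _
    obtain ⟨hk₀I, hk₀a⟩ := Finset.mem_filter.1 hk₀mem
    rw [Finset.mem_Ico] at hk₀I
    obtain ⟨b, hb, hother⟩ := tc_exists_axis hω (show k₀ < n by omega)
    by_cases hba : b = a
    · subst hba
      rcases hb with hb | hb <;> rw [hb] at htel <;> norm_num at htel
    · -- `ax k₀ = a`: every coordinate other than `a` is unchanged at step `k₀`, in particular the changed one `b` — absurd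
      have h0 := hax k₀ hk₀I.1 hk₀I.2 b (by rw [hk₀a]; exact hba)
      rcases hb with hb | hb <;> rw [h0, sub_self] at hb <;> norm_num at hb
  rw [Nat.card_Ico] at hfib
  rw [hfib]
  calc 2 * ((Finset.Ico i j).image ax).card = ∑ _a ∈ (Finset.Ico i j).image ax, 2 := by
        rw [Finset.sum_const, smul_eq_mul, mul_comm]
    _ ≤ ∑ a ∈ (Finset.Ico i j).image ax, ((Finset.Ico i j).filter fun k => ax k = a).card := Finset.sum_le_sum htwo

end Repeat

/-! ### A memory-2 walk with a repeated site uses at most `n − 2` axes -/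

section RepeatAxes

variable {D n : ℕ}

/-- ★★ A REPEAT COSTS TWO AXES: an `n`-step walk of `ℤ^D` with memory `2` and a repeated site that uses every axis has `D + 2 ≤ n`.
The first and second visits `i < j` to a repeated site are `≥ 3` steps apart (memory `2`); on `[i, j)` every stepped axis is stepped
twice (`two_mul_card_image_le_of_loop`), so at most `(j − i)/2 + (n − (j − i)) ≤ n − 2` axes are stepped on at all, and every used axis is
stepped on. [cite: MadrasSlade1993, §1.2 (p. 10: memory 2 rules out immediate reversals); lane lemma] -/
theorem dim_add_two_le_of_repeat {ω : ℕ → Site D} (hω : ω ∈ memWalks D 2 n)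
    (hrep : ∃ i ≤ n, ∃ j ≤ n, i < j ∧ ω i = ω j) (hall : ∀ a : Fin D, ∃ i ≤ n, ω i a ≠ (0 : ℤ)) : D + 2 ≤ n := by
  classical
  obtain ⟨hw, hmem⟩ := mem_memWalks.1 hω
  have h0 : ω 0 = 0 := (mem_walks.1 hw).1
  obtain ⟨i, hi, j, hj, hij, hloop⟩ := hrep
  -- memory 2: the repeat is at distance ≥ 3
  have hgap : i + 3 ≤ j := by
    by_contra hlt
    exact hmem i j hj hij (by omega) hloop
  have hn : 0 < n := by omega
  -- the axis of each step
  obtain ⟨a₀, -, -⟩ := tc_exists_axis hw hn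
  have hch : ∀ k, k < n → ∃ a : Fin D, (ω (k + 1) a - ω k a = 1 ∨ ω (k + 1) a - ω k a = -1) ∧
      ∀ b, b ≠ a → ω (k + 1) b = ω k b := fun k hk => tc_exists_axis hw hk
  set ax : ℕ → Fin D := fun k => if hk : k < n then Classical.choose (hch k hk) else a₀ with hax
  have hax_spec : ∀ k, k < n → ∀ b, b ≠ ax k → ω (k + 1) b = ω k b := by
    intro k hk b hb
    have hb' : b ≠ Classical.choose (hch k hk) := by
      intro h; apply hb; rw [hax]; simp only [dif_pos hk]; exact h
    exact (Classical.choose_spec (hch k hk)).2 b hb'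
  -- (1) every axis is stepped on: `univ ⊆ ax '' [0, n)`
  have hcover : (Finset.univ : Finset (Fin D)) ⊆ (Finset.range n).image ax := by
    intro a _
    obtain ⟨t, ht, hne⟩ := hall a
    obtain ⟨k, hk, hstep⟩ := tc_exists_step_ne h0 hne
    have hkn : k < n := by omega
    refine Finset.mem_image.2 ⟨k, Finset.mem_range.2 hkn, ?_⟩
    by_contra hka
    exact hstep (hax_spec k hkn a (fun h => hka h.symm))
  have hD : D ≤ ((Finset.range n).image ax).card := by
    have := Finset.card_le_card hcover
    rwa [Finset.card_univ, Fintype.card_fin] at this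
  -- (2) split `[0, n)` into the loop `[i, j)` and the rest
  have hIco : Finset.Ico i j ⊆ Finset.range n := fun k hk => by
    rw [Finset.mem_Ico] at hk; rw [Finset.mem_range]; omega
  have hsplit : ((Finset.range n).image ax).card ≤
      ((Finset.Ico i j).image ax).card + (n - (j - i)) := by
    have hunion : (Finset.range n).image ax ⊆ (Finset.Ico i j).image ax ∪ (Finset.range n \ Finset.Ico i j).image ax := by
      intro a ha
      obtain ⟨k, hk, rfl⟩ := Finset.mem_image.1 ha
      by_cases hkI : k ∈ Finset.Ico i j
      · exact Finset.mem_union_left _ (Finset.mem_image_of_mem _ hkI)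
      · exact Finset.mem_union_right _ (Finset.mem_image_of_mem _ (Finset.mem_sdiff.2 ⟨hk, hkI⟩))
    calc ((Finset.range n).image ax).card
        ≤ ((Finset.Ico i j).image ax ∪ (Finset.range n \ Finset.Ico i j).image ax).card := Finset.card_le_card hunion
      _ ≤ ((Finset.Ico i j).image ax).card + ((Finset.range n \ Finset.Ico i j).image ax).card := Finset.card_union_le _ _
      _ ≤ ((Finset.Ico i j).image ax).card + (Finset.range n \ Finset.Ico i j).card :=
          Nat.add_le_add_left Finset.card_image_le _
      _ = ((Finset.Ico i j).image ax).card + (n - (j - i)) := by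
          rw [Finset.card_sdiff_of_subset hIco, Finset.card_range, Nat.card_Ico]
  -- (3) the loop lemma
  have hloop2 : 2 * ((Finset.Ico i j).image ax).card ≤ j - i :=
    two_mul_card_image_le_of_loop hw hij.le hj hloop ax fun k _ hk b hb => hax_spec k (by omega) b hb
  omega

/-- ★★ Hence the «all axes used» class of non-self-avoiding memory-2 walks of `ℤ^u` of length `n` is EMPTY unless `u + 2 ≤ n`.
[cite: MadrasSlade1993, §1.2 (p. 10); lane lemma] -/
theorem card_allAxes_badClass_eq_zero {u n : ℕ} (h : n < u + 2) :
    ((memWalks u 2 n).filter fun (ω : ℕ → Site u) => (∃ i ≤ n, ∃ j ≤ n, i < j ∧ ω i = ω j) ∧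
        ∀ a : Fin u, ∃ i ≤ n, ω i a ≠ (0 : ℤ)).card = 0 := by
  rw [Finset.card_eq_zero, Finset.filter_eq_empty_iff]
  rintro ω hω ⟨hrep, hall⟩
  have := dim_add_two_le_of_repeat hω hrep hall
  omega

end RepeatAxes

/-! ### Axis classes of the non-self-avoiding memory-2 walks -/

section Classes

variable {d u n : ℕ}

/-- A walk is frozen after time `n`, so a coordinate vanishing up to time `n` vanishes at all times.
[cite: MadrasSlade1993, §1.2 (p. 10); lane plumbing] -/
private theorem tc_apply_eq_zero_of_forall_le {D : ℕ} {ω : ℕ → Site D} (hω : ω ∈ walks D n) {j : Fin D}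
    (h : ∀ i ≤ n, ω i j = 0) (i : ℕ) : ω i j = 0 := by
  by_cases hi : i ≤ n
  · exact h i hi
  · rw [(mem_walks.1 hω).2.1 i (by omega)]
    exact h n le_rfl

/-- ★ The `n`-step memory-2 walks of `ℤ^{d+1}` with a repeated site whose set of used axes is exactly `S` (`|S| = u + 1`) are
equinumerous with those of `ℤ^{u+1}` that use every axis: the zero-extension along the increasing bijection `Fin (u+1) ≃ S` is a
bijection between the two classes. [cite: MadrasSlade1993, §1.1 eq. (1.1.8) and Notes §1.6 (the 1/d-expansion device); lane theorem] -/
theorem card_badClass_eq (S : Finset (Fin (d + 1))) (hS : S.card = u + 1) :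
    ((memWalks (d + 1) 2 n).filter fun (Ω : ℕ → Site (d + 1)) => (∃ i ≤ n, ∃ j ≤ n, i < j ∧ Ω i = Ω j) ∧
        (Finset.univ.filter fun (j : Fin (d + 1)) => ∃ i ≤ n, Ω i j ≠ (0 : ℤ)) = S).card =
    ((memWalks (u + 1) 2 n).filter fun (ω : ℕ → Site (u + 1)) => (∃ i ≤ n, ∃ j ≤ n, i < j ∧ ω i = ω j) ∧
        ∀ a : Fin (u + 1), ∃ i ≤ n, ω i a ≠ (0 : ℤ)).card := by
  classical
  set e : Fin (u + 1) → Fin (d + 1) := fun a => S.orderEmbOfFin hS a with hedef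
  have he : Function.Injective e := fun a b h => (S.orderEmbOfFin hS).injective h
  have hmemS : ∀ a, e a ∈ S := fun a => Finset.orderEmbOfFin_mem S hS a
  have hrange : ∀ j, j ∈ S → ∃ a, e a = j := by
    intro j hj
    have : j ∈ Set.range (S.orderEmbOfFin hS) := by rw [Finset.range_orderEmbOfFin]; exact hj
    obtain ⟨a, ha⟩ := this
    exact ⟨a, ha⟩
  -- the repeat predicate is transported
  have hrep : ∀ ω : ℕ → Site (u + 1),
      (∃ i ≤ n, ∃ j ≤ n, i < j ∧ Function.extend e (ω i) (0 : Fin (d + 1) → ℤ) = Function.extend e (ω j) 0) ↔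
        (∃ i ≤ n, ∃ j ≤ n, i < j ∧ ω i = ω j) := by
    intro ω
    simp only [tc_extend_eq_extend_iff he]
  -- a restriction is re-extended to itself when the axes outside `S` are unused
  have hext : ∀ Ω : ℕ → Site (d + 1), Ω ∈ walks (d + 1) n →
      (Finset.univ.filter fun (j : Fin (d + 1)) => ∃ i ≤ n, Ω i j ≠ (0 : ℤ)) = S →
      (fun k => Function.extend e (fun a => Ω k (e a)) (0 : Fin (d + 1) → ℤ)) = Ω := by
    intro Ω hwalk hLU
    funext k j
    by_cases hj : ∃ a, e a = j
    · obtain ⟨a, rfl⟩ := hj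
      rw [tc_extend_apply_image he]
    · rw [tc_extend_apply_of_not_exists _ hj]
      have hjS : j ∉ S := fun h => hj (hrange j h)
      rw [← hLU, Finset.mem_filter] at hjS
      symm
      refine tc_apply_eq_zero_of_forall_le hwalk (fun i hi => ?_) k
      by_contra hne
      exact hjS ⟨Finset.mem_univ _, i, hi, hne⟩
  symm
  refine Finset.card_nbij' (fun (ω : ℕ → Site (u + 1)) (k : ℕ) => Function.extend e (ω k) (0 : Fin (d + 1) → ℤ))
    (fun (Ω : ℕ → Site (d + 1)) (k : ℕ) (a : Fin (u + 1)) => Ω k (e a)) ?_ ?_ ?_ ?_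
  · -- maps into the class of `S`
    intro ω hω
    rw [Finset.mem_coe, Finset.mem_filter] at hω ⊢
    obtain ⟨hωM, hωr, hall⟩ := hω
    refine ⟨(extend_mem_memWalks_iff he ω).2 hωM, (hrep ω).2 hωr, ?_⟩
    ext j
    simp only [Finset.mem_filter, Finset.mem_univ, true_and]
    constructor
    · rintro ⟨i, hi, hne⟩
      have hjT : ∃ a, e a = j := by
        by_contra hne'
        exact hne (tc_extend_apply_of_not_exists _ hne')
      obtain ⟨a, rfl⟩ := hjT
      exact hmemS a
    · intro hj
      obtain ⟨a, rfl⟩ := hrange j hj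
      obtain ⟨i, hi, hne⟩ := hall a
      exact ⟨i, hi, by rwa [tc_extend_apply_image he]⟩
  · -- the restriction maps into the «all axes used» class
    intro Ω hΩ
    rw [Finset.mem_coe, Finset.mem_filter] at hΩ ⊢
    obtain ⟨hΩM, hΩr, hLU⟩ := hΩ
    have hwalk : Ω ∈ walks (d + 1) n := (mem_memWalks.1 hΩM).1
    have hΩext := hext Ω hwalk hLU
    refine ⟨(extend_mem_memWalks_iff he _).1 (by rw [hΩext]; exact hΩM), (hrep _).1 (by
      simp only [show ∀ k, Function.extend e (fun a => Ω k (e a)) (0 : Fin (d + 1) → ℤ) = Ω k from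
        fun k => congrFun hΩext k]; exact hΩr), ?_⟩
    intro a
    have haS : e a ∈ S := hmemS a
    rw [← hLU, Finset.mem_filter] at haS
    exact haS.2
  · -- left inverse
    intro ω _
    funext k a
    exact tc_extend_apply_image he (ω k) a
  · -- right inverse
    intro Ω hΩ
    rw [Finset.mem_coe, Finset.mem_filter] at hΩ
    obtain ⟨hΩM, -, hLU⟩ := hΩ
    exact hext Ω (mem_memWalks.1 hΩM).1 hLU

/-- There are no walks of positive length in `ℤ^0`. [cite: MadrasSlade1993, §1.1 (p. 1); lane plumbing] -/
private theorem tc_walks_zero_dim (hn : 1 ≤ n) : walks 0 n = ∅ := by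
  rw [Finset.eq_empty_iff_forall_notMem]
  intro ω hω
  obtain ⟨j, -⟩ := (zdGraph_adj_iff_sub _ _).1 ((mem_walks.1 hω).2.2 0 (by omega))
  exact Fin.elim0 j

/-- A walk of positive length uses at least one axis (its first step). [cite: MadrasSlade1993, §1.1 (p. 1); lane plumbing] -/
private theorem tc_usedAxes_nonempty {D : ℕ} {Ω : ℕ → Site D} (hΩ : Ω ∈ walks D n) (hn : 1 ≤ n) :
    (Finset.univ.filter fun (j : Fin D) => ∃ i ≤ n, Ω i j ≠ (0 : ℤ)) ≠ ∅ := by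
  obtain ⟨h0, -, hadj⟩ := mem_walks.1 hΩ
  obtain ⟨j, s, hs, hjs⟩ := tc_exists_step_single hΩ (show 0 < n by omega)
  rw [← Finset.nonempty_iff_ne_empty]
  refine ⟨j, Finset.mem_filter.2 ⟨Finset.mem_univ _, 1, hn, ?_⟩⟩
  have h := congrFun hjs j
  rw [Pi.sub_apply, Pi.single_eq_same, zero_add, h0, Pi.zero_apply, sub_zero] at h
  rw [h]
  rcases hs with rfl | rfl <;> norm_num

/-- ★★ THE AXIS-CLASS IDENTITY FOR THE NON-SELF-AVOIDING MEMORY-2 WALKS: for every `n ≥ 1` and EVERY dimension `d`, the number of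
`n`-step memory-2 walks of `ℤ^d` with a repeated site is `Σ_{u ≤ n−2} C(d,u) · G_n(u)`, where `G_n(u)` is the number of such walks of
`ℤ^u` using every axis (a natural number independent of `d`; the classes `u ≥ n − 1` are empty by `card_allAxes_badClass_eq_zero`).
[cite: MadrasSlade1993, §1.1 eq. (1.1.8) and Notes §1.6 (the 1/d-expansion device); §1.2 (p. 10); lane theorem] -/
theorem card_bad_eq_sum_choose_mul (d : ℕ) (hn : 1 ≤ n) :
    ((memWalks d 2 n).filter fun (Ω : ℕ → Site d) => ∃ i ≤ n, ∃ j ≤ n, i < j ∧ Ω i = Ω j).card =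
      ∑ u ∈ Finset.range (n - 1), d.choose u *
        ((memWalks u 2 n).filter fun (ω : ℕ → Site u) => (∃ i ≤ n, ∃ j ≤ n, i < j ∧ ω i = ω j) ∧
          ∀ a : Fin u, ∃ i ≤ n, ω i a ≠ (0 : ℤ)).card := by
  classical
  -- abbreviation for the class counts
  set G : ℕ → ℕ := fun u => ((memWalks u 2 n).filter fun (ω : ℕ → Site u) => (∃ i ≤ n, ∃ j ≤ n, i < j ∧ ω i = ω j) ∧
    ∀ a : Fin u, ∃ i ≤ n, ω i a ≠ (0 : ℤ)).card with hG
  have hG0 : G 0 = 0 := by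
    rw [hG]
    simp only
    rw [Finset.card_eq_zero, Finset.filter_eq_empty_iff]
    intro ω hω
    have := (mem_memWalks.1 hω).1
    rw [tc_walks_zero_dim hn] at this
    exact absurd this (Finset.notMem_empty ω)
  have hGvan : ∀ u, n - 1 ≤ u → G u = 0 := fun u hu => by
    rw [hG]
    exact card_allAxes_badClass_eq_zero (by omega)
  -- both sides equal the sum over `range (d + n)`
  have key : ∀ K L : ℕ, (∀ u, K ≤ u → d.choose u * G u = 0) → K ≤ L →
      ∑ u ∈ Finset.range K, d.choose u * G u = ∑ u ∈ Finset.range L, d.choose u * G u := by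
    intro K L hKz hKL
    exact Finset.sum_subset (Finset.range_mono hKL) fun u _ hu => hKz u (by simpa [Finset.mem_range] using hu)
  change _ = ∑ u ∈ Finset.range (n - 1), d.choose u * G u
  rw [key (n - 1) (d + n) (fun u hu => by rw [hGvan u hu, mul_zero]) (by omega),
    ← key (d + 1) (d + n) (fun u hu => by rw [Nat.choose_eq_zero_of_lt (by omega), zero_mul]) (by omega)]
  -- the class decomposition in dimension `d`
  rcases d with _ | d
  · -- dimension 0: no walks at all
    rw [Finset.sum_range_one, Nat.choose_zero_right, one_mul, hG0, Finset.card_eq_zero, Finset.filter_eq_empty_iff]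
    intro ω hω
    have := (mem_memWalks.1 hω).1
    rw [tc_walks_zero_dim hn] at this
    exact absurd this (Finset.notMem_empty ω)
  · set W := (memWalks (d + 1) 2 n).filter (fun (Ω : ℕ → Site (d + 1)) => ∃ i ≤ n, ∃ j ≤ n, i < j ∧ Ω i = Ω j) with hW
    set P := (Finset.univ : Finset (Fin (d + 1))).powerset with hP
    have hmaps : ∀ Ω ∈ W, (Finset.univ.filter fun (j : Fin (d + 1)) => ∃ i ≤ n, Ω i j ≠ (0 : ℤ)) ∈ P := by
      intro Ω _
      rw [hP, Finset.mem_powerset]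
      exact Finset.filter_subset _ _
    rw [Finset.card_eq_sum_card_fiberwise hmaps]
    have hfib : ∀ S ∈ P, (W.filter fun Ω => (Finset.univ.filter fun (j : Fin (d + 1)) => ∃ i ≤ n, Ω i j ≠ (0 : ℤ)) = S).card =
        G S.card := by
      intro S _
      rw [hW, Finset.filter_filter]
      rcases Nat.eq_zero_or_pos S.card with h0 | hpos
      · -- the empty class is empty, and `G 0 = 0`
        rw [h0, hG0, Finset.card_eq_zero, Finset.filter_eq_empty_iff]
        rintro Ω hΩ ⟨-, hS⟩
        rw [Finset.card_eq_zero] at h0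
        rw [h0] at hS
        exact tc_usedAxes_nonempty (mem_memWalks.1 hΩ).1 hn hS
      · obtain ⟨u, hu⟩ : ∃ u, S.card = u + 1 := ⟨S.card - 1, by omega⟩
        rw [hu, hG]
        exact card_badClass_eq S hu
    rw [Finset.sum_congr rfl hfib]
    have hsum := Finset.sum_powerset_apply_card (fun u : ℕ => G u) (x := (Finset.univ : Finset (Fin (d + 1))))
    rw [Finset.card_univ, Fintype.card_fin] at hsum
    rw [hP, hsum]
    simp only [smul_eq_mul]

end Classes

/-! ### Assembly: `c_n(ℤ^d) = 2d(2d−1)^{n−1} − Σ_{u ≤ n−2} C(d,u) G_n(u)` and the top two coefficients -/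

section Assembly

variable {d n : ℕ}

/-- A memory-2 walk is self-avoiding iff it has no repeated site. [cite: MadrasSlade1993, §1.2 (p. 10); lane plumbing] -/
private theorem tc_mem_saws_iff_not_repeat {ω : ℕ → Site d} (hω : ω ∈ memWalks d 2 n) :
    ω ∈ saws d n ↔ ¬ ∃ i ≤ n, ∃ j ≤ n, i < j ∧ ω i = ω j := by
  obtain ⟨hw, -⟩ := mem_memWalks.1 hω
  obtain ⟨h0, hend, hadj⟩ := mem_walks.1 hw
  constructor
  · rintro hs ⟨i, hi, j, hj, hij, heq⟩
    have := (mem_saws.1 hs).2.2.2 (show i ∈ {k | k ≤ n} by simp only [Set.mem_setOf_eq]; omega)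
      (show j ∈ {k | k ≤ n} from hj) heq
    omega
  · intro h
    refine mem_saws.2 ⟨h0, hend, hadj, fun i hi j hj hij => ?_⟩
    simp only [Set.mem_setOf_eq] at hi hj
    by_contra hne
    rcases lt_or_gt_of_ne hne with hlt | hlt
    · exact h ⟨i, hi, j, hj, hlt, hij⟩
    · exact h ⟨j, hj, i, hi, hlt, hij.symm⟩

/-- ★ `c_{n,2}(ℤ^d) = c_n(ℤ^d) + #{memory-2 walks with a repeated site}`. [cite: MadrasSlade1993, §1.2 (p. 10: "c_{N,τ} ≥ c_N"); lane lemma] -/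
theorem memCount_two_eq_count_add_card_bad (d n : ℕ) :
    memCount d 2 n = count d n +
      ((memWalks d 2 n).filter fun (Ω : ℕ → Site d) => ∃ i ≤ n, ∃ j ≤ n, i < j ∧ Ω i = Ω j).card := by
  classical
  have hsplit := Finset.card_filter_add_card_filter_not
    (s := memWalks d 2 n) (fun (Ω : ℕ → Site d) => ∃ i ≤ n, ∃ j ≤ n, i < j ∧ Ω i = Ω j)
  have hsaws : (memWalks d 2 n).filter (fun (Ω : ℕ → Site d) => ¬ ∃ i ≤ n, ∃ j ≤ n, i < j ∧ Ω i = Ω j) = saws d n := by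
    ext ω
    rw [Finset.mem_filter]
    constructor
    · rintro ⟨hω, h⟩
      exact (tc_mem_saws_iff_not_repeat hω).2 h
    · intro hω
      have hm : ω ∈ memWalks d 2 n := saws_subset_memWalks d 2 n hω
      exact ⟨hm, (tc_mem_saws_iff_not_repeat hm).1 hω⟩
  rw [hsaws, card_saws] at hsplit
  rw [memCount, ← hsplit, add_comm]

/-- ★★ For every `n ≥ 1` and EVERY `d`: `c_{n,2}(ℤ^d) = c_n(ℤ^d) + Σ_{u ≤ n−2} C(d,u) · G_n(u)`, `G_n(u)` = the number of `n`-step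
memory-2 walks of `ℤ^u` with a repeated site using every axis. [cite: MadrasSlade1993, §1.1 eq. (1.1.8); §1.2 (p. 10); lane theorem] -/
theorem memCount_two_eq_count_add_sum_choose (d : ℕ) (hn : 1 ≤ n) :
    memCount d 2 n = count d n + ∑ u ∈ Finset.range (n - 1), d.choose u *
      ((memWalks u 2 n).filter fun (ω : ℕ → Site u) => (∃ i ≤ n, ∃ j ≤ n, i < j ∧ ω i = ω j) ∧
        ∀ a : Fin u, ∃ i ≤ n, ω i a ≠ (0 : ℤ)).card := by
  rw [memCount_two_eq_count_add_card_bad, card_bad_eq_sum_choose_mul d hn]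

/-- `c_{n,2}(ℤ^d) = 2d(2d−1)^{n−1}` as rational numbers, for every `d` (the empty dimension included).
[cite: MadrasSlade1993, §1.2 (p. 10)] -/
private theorem tc_memCount_two_cast (d : ℕ) (hn : 1 ≤ n) :
    (memCount d 2 n : ℚ) = 2 * (d : ℚ) * (2 * (d : ℚ) - 1) ^ (n - 1) := by
  rcases Nat.eq_zero_or_pos d with rfl | hd
  · have : memCount 0 2 n = 0 := by
      rw [memCount, Finset.card_eq_zero, Finset.eq_empty_iff_forall_notMem]
      intro ω hω
      have := (mem_memWalks.1 hω).1
      rw [tc_walks_zero_dim hn] at this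
      exact Finset.notMem_empty ω this
    rw [this]; simp
  · haveI : NeZero d := ⟨by omega⟩
    rw [memCount_two d hn]
    have h1 : 1 ≤ 2 * d := by omega
    push_cast [Nat.cast_sub h1]
    ring

/-- The top two coefficients of `(2X − 1)^m`: `[X^m] = 2^m` and `2·[X^{m−1}] = −m·2^m` (the latter written as `[X^m]((2X−1)^m · X)`).
[cite: MadrasSlade1993, §1.2 (p. 10); lane plumbing] -/
private theorem tc_coeff_twoX_sub_one_pow (m : ℕ) :
    ((Polynomial.C (2 : ℚ) * Polynomial.X - 1) ^ m).natDegree ≤ m ∧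
    ((Polynomial.C (2 : ℚ) * Polynomial.X - 1) ^ m).coeff m = 2 ^ m ∧
    2 * (((Polynomial.C (2 : ℚ) * Polynomial.X - 1) ^ m * Polynomial.X).coeff m) = -(m : ℚ) * 2 ^ m := by
  have hB : (Polynomial.C (2 : ℚ) * Polynomial.X - 1).natDegree ≤ 1 := by
    refine (Polynomial.natDegree_sub_le _ _).trans (max_le ?_ (by simp))
    exact Polynomial.natDegree_C_mul_le _ _ |>.trans (by simp)
  induction m with
  | zero =>
    refine ⟨by simp, by simp, ?_⟩
    rw [pow_zero, one_mul, Polynomial.coeff_X_zero]; simp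
  | succ m ih =>
    obtain ⟨hdeg, htop, hsec⟩ := ih
    have hdeg' : ((Polynomial.C (2 : ℚ) * Polynomial.X - 1) ^ (m + 1)).natDegree ≤ m + 1 :=
      Polynomial.natDegree_pow_le_of_le (m + 1) hB |>.trans (by omega)
    have hexp : (Polynomial.C (2 : ℚ) * Polynomial.X - 1) ^ (m + 1) =
        Polynomial.C 2 * ((Polynomial.C (2 : ℚ) * Polynomial.X - 1) ^ m * Polynomial.X) -
          (Polynomial.C (2 : ℚ) * Polynomial.X - 1) ^ m := by
      rw [pow_succ]; ring
    have hzero : ((Polynomial.C (2 : ℚ) * Polynomial.X - 1) ^ m).coeff (m + 1) = 0 :=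
      Polynomial.coeff_eq_zero_of_natDegree_lt (by omega)
    refine ⟨hdeg', ?_, ?_⟩
    · rw [hexp, Polynomial.coeff_sub, Polynomial.coeff_C_mul, Polynomial.coeff_mul_X, htop, hzero, pow_succ]; ring
    · have hexp' : (Polynomial.C (2 : ℚ) * Polynomial.X - 1) ^ (m + 1) * Polynomial.X =
          Polynomial.C 2 * ((Polynomial.C (2 : ℚ) * Polynomial.X - 1) ^ m * Polynomial.X * Polynomial.X) -
            (Polynomial.C (2 : ℚ) * Polynomial.X - 1) ^ m * Polynomial.X := by
        rw [hexp]; ring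
      rw [hexp', Polynomial.coeff_sub, Polynomial.coeff_C_mul, Polynomial.coeff_mul_X, Polynomial.coeff_mul_X, htop]
      have : 2 * (2 * (((Polynomial.C (2 : ℚ) * Polynomial.X - 1) ^ m * Polynomial.X).coeff m) - 2 ^ m) =
          -((m + 1 : ℕ) : ℚ) * 2 ^ (m + 1) := by
        rw [mul_sub, hsec]; push_cast; ring
      linear_combination this

/-- ★★★ THE TOP TWO COEFFICIENTS OF `c_n(ℤ^d)` IN THE DIMENSION: for every `n ≥ 1` there is a polynomial `P ∈ ℚ[X]` of degree `≤ n`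
with `[X^n] P = 2^n`, `[X^{n−1}] P = −(n−1)·2^{n−1}` and `c_n(ℤ^d) = P(d)` for EVERY `d ∈ ℕ`
(`P = 2X(2X−1)^{n−1} − Σ_{u ≤ n−2} G_n(u) · X(X−1)⋯(X−u+1)/u!`: non-reversing words minus the classes of the non-self-avoiding ones).
[cite: MadrasSlade1993, §1.1 p. 3 (c₁…c₄ in d) and eq. (1.1.8) p. 5 (the 1/d expansion); §1.2 p. 10; lane theorem] -/
theorem exists_polynomial_count_topTwo (hn : 1 ≤ n) :
    ∃ P : Polynomial ℚ, P.natDegree ≤ n ∧ P.coeff n = (2 : ℚ) ^ n ∧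
      P.coeff (n - 1) = -((n - 1 : ℕ) : ℚ) * 2 ^ (n - 1) ∧ ∀ d : ℕ, (count d n : ℚ) = P.eval (d : ℚ) := by
  classical
  obtain ⟨m, rfl⟩ : ∃ m, n = m + 1 := ⟨n - 1, by omega⟩
  simp only [Nat.add_sub_cancel]
  obtain ⟨hRdeg, hRtop, hRsec⟩ := tc_coeff_twoX_sub_one_pow m
  set G : ℕ → ℕ := fun u => ((memWalks u 2 (m + 1)).filter fun (ω : ℕ → Site u) =>
    (∃ i ≤ m + 1, ∃ j ≤ m + 1, i < j ∧ ω i = ω j) ∧ ∀ a : Fin u, ∃ i ≤ m + 1, ω i a ≠ (0 : ℤ)).card with hG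
  set R : Polynomial ℚ := (Polynomial.C (2 : ℚ) * Polynomial.X - 1) ^ m with hR
  set B : Polynomial ℚ := ∑ u ∈ Finset.range m, Polynomial.C ((G u : ℚ) / (u.factorial : ℚ)) * descPochhammer ℚ u
    with hBdef
  have hBcoeff : ∀ k, m ≤ k → B.coeff k = 0 := by
    intro k hk
    rw [hBdef, Polynomial.finsetSum_coeff]
    refine Finset.sum_eq_zero fun u hu => ?_
    rw [Polynomial.coeff_C_mul, Polynomial.coeff_eq_zero_of_natDegree_lt, mul_zero]
    rw [descPochhammer_natDegree]
    have := Finset.mem_range.1 hu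
    omega
  have hBdeg : B.natDegree ≤ m := by
    refine Polynomial.natDegree_sum_le_of_forall_le _ _ fun u hu => ?_
    calc (Polynomial.C ((G u : ℚ) / (u.factorial : ℚ)) * descPochhammer ℚ u).natDegree
        ≤ (descPochhammer ℚ u).natDegree := Polynomial.natDegree_C_mul_le _ _
      _ = u := descPochhammer_natDegree ℚ u
      _ ≤ m := by have := Finset.mem_range.1 hu; omega
  refine ⟨Polynomial.C 2 * (R * Polynomial.X) - B, ?_, ?_, ?_, ?_⟩
  · refine (Polynomial.natDegree_sub_le _ _).trans (max_le ?_ (hBdeg.trans (Nat.le_succ m)))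
    refine (Polynomial.natDegree_C_mul_le _ _).trans (Polynomial.natDegree_mul_le.trans ?_)
    rw [Polynomial.natDegree_X]; omega
  · rw [Polynomial.coeff_sub, Polynomial.coeff_C_mul, hBcoeff (m + 1) (Nat.le_succ m), sub_zero,
      Polynomial.coeff_mul_X, hRtop, pow_succ]; ring
  · rw [Polynomial.coeff_sub, Polynomial.coeff_C_mul, hBcoeff m le_rfl, sub_zero]
    linear_combination hRsec
  · intro d
    have hm1 : 1 ≤ m + 1 := Nat.succ_pos m
    rw [Polynomial.eval_sub, Polynomial.eval_mul, Polynomial.eval_C, Polynomial.eval_mul, Polynomial.eval_X, hR,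
      Polynomial.eval_pow, Polynomial.eval_sub, Polynomial.eval_mul, Polynomial.eval_C, Polynomial.eval_X,
      Polynomial.eval_one]
    have hcount : (count d (m + 1) : ℚ) =
        (memCount d 2 (m + 1) : ℚ) - ∑ u ∈ Finset.range m, (d.choose u : ℚ) * (G u : ℚ) := by
      have h := memCount_two_eq_count_add_sum_choose d hm1
      rw [Nat.add_sub_cancel] at h
      rw [h]; push_cast; ring
    have hmem := tc_memCount_two_cast d hm1
    rw [Nat.add_sub_cancel] at hmem
    rw [hcount, hmem, hBdef, Polynomial.eval_finsetSum]
    congr 1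
    · ring
    · refine Finset.sum_congr rfl fun u _ => ?_
      have hf : (u.factorial : ℚ) ≠ 0 := by exact_mod_cast u.factorial_ne_zero
      rw [Polynomial.eval_mul, Polynomial.eval_C, descPochhammer_eval_eq_descFactorial ℚ d u,
        Nat.descFactorial_eq_factorial_mul_choose, Nat.cast_mul, div_mul_eq_mul_div, mul_div_assoc,
        mul_div_cancel_left₀ _ hf, mul_comm]

/-- ★ The same polynomial with its second coefficient in the shift-invariant form `[X^n](P · X) = −(n−1)·2^{n−1}` used by symbol
calculus (`(P · X).coeff n = P.coeff (n − 1)` for `n ≥ 1`). [cite: MadrasSlade1993, §1.1 eq. (1.1.8) p. 5; lane theorem] -/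
theorem exists_polynomial_count_topTwo' (hn : 1 ≤ n) :
    ∃ P : Polynomial ℚ, P.natDegree ≤ n ∧ P.coeff n = (2 : ℚ) ^ n ∧
      (P * Polynomial.X).coeff n = -((n : ℚ) - 1) * 2 ^ (n - 1) ∧ ∀ d : ℕ, (count d n : ℚ) = P.eval (d : ℚ) := by
  obtain ⟨P, hdeg, htop, hsec, hev⟩ := exists_polynomial_count_topTwo hn
  refine ⟨P, hdeg, htop, ?_, hev⟩
  obtain ⟨m, rfl⟩ : ∃ m, n = m + 1 := ⟨n - 1, by omega⟩
  rw [Polynomial.coeff_mul_X, Nat.add_sub_cancel] at *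
  rw [hsec]; push_cast; ring

end Assembly
end Literature.Probability.RandomPlanarGeometry.SAW.Zd
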